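import Mathlib

/-!
# Label-space four-set packing: the generic common-quotient regime has `T ≤ n/2` (solo-informed gen 87, CLAIMS c661)

Setting (dossier `paper/val-superlinear.md` §15.8 (n)(xxv), `work/g87/cyc/CYC.md` §6).  For an accidental-free PURE design in
`G = 𝔽₂^m` whose class subspaces `R_t` all lie in one subspace `S` of codimension `q` with `R_t + R_u = S` (the *common-quotient
regime*), everything about territorial overlaps is read in the quotient `Λ = G/S` through the block labels `λ_t = λ(c_t)`,
`μ_t = λ(y_t)` and the row-label sets `L_t = λ(X_t) ⊆ Λ`; one has `T/n ≤ (Σ_t |L_t|)/2^q`.  When every cross condition is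
*S-type* (generic splittings) the criterion says, in `Λ`:
* (Q2) no two labels of block `t` sum to `λ_t + λ_u` (`u ≠ t`);
* (Z)  no `ℓ ∈ L_t, ℓ' ∈ L_u` with `ℓ + ℓ' = λ_t + μ_t + λ_u + μ_u` (`t ≠ u`);
* (Y)  no `ℓ ∈ L_t, ℓ' ∈ L_u` with `ℓ + ℓ' = μ_t + μ_u` (`t ≠ u`);
* (P5) no `ℓ ∈ L_t, ℓ' ∈ L_u` with `ℓ + ℓ' = μ_t + λ_u + μ_u + λ_b` (`t, u, b` pairwise distinct).

THEOREM (`two_mul_sum_card_le_of_label_packing`).  Under these four hypotheses, in any finite abelian group of exponent two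
with at least two blocks, `2 · Σ_t |L_t| ≤ |Λ|`.  Hence `Σ_t |L_t| ≤ 2^{q-1}` and `T ≤ n/2` in the generic regime
(conjecture "Q-half", c657, now a theorem).  PROOF: fix blocks `a ≠ a'`; the `2k` translates
`P_a = L_a + λ_a`, `P_c = L_c + (μ_a + λ_c + μ_c)` (`c ≠ a`), `Q_a = L_a + λ_{a'}`, `Q_c = L_c + (λ_a + μ_a + μ_c)` (`c ≠ a`)
— the label shadows of the four packing sets `M_a, U_a, V_a, Ṽ_a` of `SoloInformedValFourSet` — are pairwise disjoint, each
disjointness being literally one of the hypotheses after substitution.  Self-contained (Mathlib only).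
-/

namespace Summit.MatrixMultiplication.MatrixMultiplication.Theorems.SoloVal

open Finset

section LabelPacking

variable {G : Type*} [AddCommGroup G]

/-- In exponent two, `ℓ + s = ℓ' + s'` implies `ℓ + ℓ' = s + s'`. -/
theorem add_eq_add_swap_of_exponent_two (h2 : ∀ g : G, g + g = 0) {ℓ s ℓ' s' : G}
    (h : ℓ + s = ℓ' + s') : ℓ + ℓ' = s + s' := by
  have hneg : ∀ g : G, -g = g := fun g => by
    rw [neg_eq_iff_add_eq_zero]; exact h2 g
  have e : (ℓ + ℓ') + (s + s') = (ℓ + s) + (ℓ' + s') := by abel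
  rw [h, h2] at e
  rw [eq_neg_of_add_eq_zero_left e, hneg]

variable [DecidableEq G] {ι : Type*} [Fintype ι] [DecidableEq ι]

/-- translate of a finite set -/
def labelShift (A : Finset G) (s : G) : Finset G := A.image (fun x => x + s)

/-- a translate has the same cardinality -/
theorem card_labelShift (A : Finset G) (s : G) : (labelShift A s).card = A.card :=
  card_image_of_injective _ (add_left_injective s)

/-- membership in a translate -/
theorem mem_labelShift {A : Finset G} {s x : G} : x ∈ labelShift A s ↔ ∃ ℓ ∈ A, ℓ + s = x := by
  simp only [labelShift, mem_image]

/-- Two translates `A + s`, `B + s'` are disjoint as soon as no `ℓ ∈ A, ℓ' ∈ B` have `ℓ + ℓ' = s + s'` (exponent two). -/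
theorem disjoint_labelShift (h2 : ∀ g : G, g + g = 0) {A B : Finset G} {s s' : G}
    (h : ∀ ℓ ∈ A, ∀ ℓ' ∈ B, ℓ + ℓ' ≠ s + s') : Disjoint (labelShift A s) (labelShift B s') := by
  rw [disjoint_left]
  intro x hx hx'
  obtain ⟨ℓ, hℓ, hℓx⟩ := mem_labelShift.1 hx
  obtain ⟨ℓ', hℓ', hℓ'x⟩ := mem_labelShift.1 hx'
  exact h ℓ hℓ ℓ' hℓ' (add_eq_add_swap_of_exponent_two h2 (hℓx.trans hℓ'x.symm))

/-- THE LABEL PACKING THEOREM (generic common-quotient regime ⇒ `Σ|L_t| ≤ |Λ|/2`). -/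
theorem two_mul_sum_card_le_of_label_packing [Fintype G] (h2 : ∀ g : G, g + g = 0)
    (L : ι → Finset G) (lam mu : ι → G) (a a' : ι) (haa' : a ≠ a')
    (hQ2 : ∀ t u, t ≠ u → ∀ ℓ ∈ L t, ∀ ℓ' ∈ L t, ℓ + ℓ' ≠ lam t + lam u)
    (hZ : ∀ t u, t ≠ u → ∀ ℓ ∈ L t, ∀ ℓ' ∈ L u, ℓ + ℓ' ≠ lam t + mu t + lam u + mu u)
    (hY : ∀ t u, t ≠ u → ∀ ℓ ∈ L t, ∀ ℓ' ∈ L u, ℓ + ℓ' ≠ mu t + mu u)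
    (hP5 : ∀ t u b, t ≠ u → b ≠ t → b ≠ u → ∀ ℓ ∈ L t, ∀ ℓ' ∈ L u, ℓ + ℓ' ≠ mu t + lam u + mu u + lam b) :
    2 * ∑ t, (L t).card ≤ Fintype.card G := by
  classical
  -- the 2k shadows
  let sP : ι → G := fun c => if c = a then lam a else mu a + lam c + mu c
  let sQ : ι → G := fun c => if c = a then lam a' else lam a + mu a + mu c
  let P : ι → Finset G := fun c => labelShift (L c) (sP c)
  let Q : ι → Finset G := fun c => labelShift (L c) (sQ c)
  have sP_a : sP a = lam a := by simp [sP]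
  have sQ_a : sQ a = lam a' := by simp [sQ]
  have sP_ne : ∀ c, c ≠ a → sP c = mu a + lam c + mu c := fun c hc => by simp [sP, hc]
  have sQ_ne : ∀ c, c ≠ a → sQ c = lam a + mu a + mu c := fun c hc => by simp [sQ, hc]
  -- a normal-form helper: `x = y + (d + d)` gives `x = y`
  have dd : ∀ (x y d : G), x = y + (d + d) → x = y := fun x y d h => by rw [h, h2, add_zero]
  -- P–P disjointness
  have hPP : ∀ c c', c ≠ c' → Disjoint (P c) (P c') := by
    intro c c' hcc'
    apply disjoint_labelShift h2
    intro ℓ hℓ ℓ' hℓ' habs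
    by_cases hc : c = a
    · subst hc
      rw [sP_a, sP_ne c' (Ne.symm hcc')] at habs
      exact hZ c c' hcc' ℓ hℓ ℓ' hℓ' (by rw [habs]; try abel)
    · by_cases hc' : c' = a
      · subst hc'
        rw [sP_a, sP_ne c hc] at habs
        exact hZ c c' hcc' ℓ hℓ ℓ' hℓ' (by rw [habs]; try abel)
      · rw [sP_ne c hc, sP_ne c' hc'] at habs
        refine hZ c c' hcc' ℓ hℓ ℓ' hℓ' (dd _ _ (mu a) ?_)
        rw [habs]; try abel
  -- Q–Q disjointness
  have hQQ : ∀ c c', c ≠ c' → Disjoint (Q c) (Q c') := by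
    intro c c' hcc'
    apply disjoint_labelShift h2
    intro ℓ hℓ ℓ' hℓ' habs
    by_cases hc : c = a
    · subst hc
      rw [sQ_a, sQ_ne c' (Ne.symm hcc')] at habs
      by_cases hc'a' : c' = a'
      · subst hc'a'
        exact hZ c c' hcc' ℓ hℓ ℓ' hℓ' (by rw [habs]; try abel)
      · -- (P5)(c', a, a')
        have := hP5 c' c a' (Ne.symm hcc') (Ne.symm hc'a') (Ne.symm haa') ℓ' hℓ' ℓ hℓ
        exact this (by rw [add_comm ℓ' ℓ, habs]; try abel)
    · by_cases hc' : c' = a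
      · subst hc'
        rw [sQ_a, sQ_ne c hc] at habs
        by_cases hca' : c = a'
        · subst hca'
          exact hZ c c' hcc' ℓ hℓ ℓ' hℓ' (by rw [habs]; try abel)
        · have := hP5 c c' a' hcc' (Ne.symm hca') (Ne.symm haa') ℓ hℓ ℓ' hℓ'
          exact this (by rw [habs]; try abel)
      · rw [sQ_ne c hc, sQ_ne c' hc'] at habs
        refine hY c c' hcc' ℓ hℓ ℓ' hℓ' (dd _ _ (lam a + mu a) ?_)
        rw [habs]; try abel
  -- P–Q disjointness
  have hPQ : ∀ c c', Disjoint (P c) (Q c') := by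
    intro c c'
    apply disjoint_labelShift h2
    intro ℓ hℓ ℓ' hℓ' habs
    by_cases hc : c = a
    · subst hc
      by_cases hc' : c' = c
      · subst hc'
        rw [sP_a, sQ_a] at habs
        exact hQ2 c' a' haa' ℓ hℓ ℓ' hℓ' habs
      · rw [sP_a, sQ_ne c' hc'] at habs
        refine hY c c' (Ne.symm hc') ℓ hℓ ℓ' hℓ' (dd _ _ (lam c) ?_)
        rw [habs]; try abel
    · by_cases hc' : c' = a
      · subst hc'
        rw [sP_ne c hc, sQ_a] at habs
        by_cases hca' : c = a'
        · subst hca'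
          have := hY c' c (Ne.symm hc) ℓ' hℓ' ℓ hℓ
          refine this (dd _ _ (lam c) ?_)
          rw [add_comm ℓ' ℓ, habs]; try abel
        · -- (P5)(a, c, a')
          have := hP5 c' c a' (Ne.symm hc) (Ne.symm haa') (Ne.symm hca') ℓ' hℓ' ℓ hℓ
          exact this (by rw [add_comm ℓ' ℓ, habs]; try abel)
      · by_cases hcc' : c = c'
        · subst hcc'
          rw [sP_ne c hc, sQ_ne c hc] at habs
          refine hQ2 c a hc ℓ hℓ ℓ' hℓ' (dd _ _ (mu a + mu c) ?_)
          rw [habs]; try abel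
        · -- (P5)(c', c, a)
          rw [sP_ne c hc, sQ_ne c' hc'] at habs
          have := hP5 c' c a (Ne.symm hcc') (Ne.symm hc') (Ne.symm hc) ℓ' hℓ' ℓ hℓ
          refine this (dd _ _ (mu a) ?_)
          rw [add_comm ℓ' ℓ, habs]; try abel
  -- count
  have cP : (univ.biUnion P).card = ∑ t, (L t).card := by
    rw [card_biUnion (fun c _ c' _ h => hPP c c' h)]
    exact sum_congr rfl (fun c _ => card_labelShift _ _)
  have cQ : (univ.biUnion Q).card = ∑ t, (L t).card := by
    rw [card_biUnion (fun c _ c' _ h => hQQ c c' h)]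
    exact sum_congr rfl (fun c _ => card_labelShift _ _)
  have dPQ : Disjoint (univ.biUnion P) (univ.biUnion Q) := by
    rw [disjoint_biUnion_left]; intro c _
    rw [disjoint_biUnion_right]; intro c' _
    exact hPQ c c'
  calc 2 * ∑ t, (L t).card = (univ.biUnion P ∪ univ.biUnion Q).card := by
        rw [card_union_of_disjoint dPQ, cP, cQ]; ring
    _ ≤ Fintype.card G := card_le_univ _

/-- Packaging: `Σ_t |L_t| ≤ |Λ|/2` (the form used in `CYC.md` §6: with `|Λ| = 2^q`, `Σ_t |L_t| ≤ 2^{q-1}`, whence `T ≤ n/2`). -/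
theorem sum_card_le_half_of_label_packing [Fintype G] (h2 : ∀ g : G, g + g = 0)
    (L : ι → Finset G) (lam mu : ι → G) (a a' : ι) (haa' : a ≠ a')
    (hQ2 : ∀ t u, t ≠ u → ∀ ℓ ∈ L t, ∀ ℓ' ∈ L t, ℓ + ℓ' ≠ lam t + lam u)
    (hZ : ∀ t u, t ≠ u → ∀ ℓ ∈ L t, ∀ ℓ' ∈ L u, ℓ + ℓ' ≠ lam t + mu t + lam u + mu u)
    (hY : ∀ t u, t ≠ u → ∀ ℓ ∈ L t, ∀ ℓ' ∈ L u, ℓ + ℓ' ≠ mu t + mu u)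
    (hP5 : ∀ t u b, t ≠ u → b ≠ t → b ≠ u → ∀ ℓ ∈ L t, ∀ ℓ' ∈ L u, ℓ + ℓ' ≠ mu t + lam u + mu u + lam b) :
    ∑ t, (L t).card ≤ Fintype.card G / 2 := by
  have h := two_mul_sum_card_le_of_label_packing h2 L lam mu a a' haa' hQ2 hZ hY hP5
  omega

end LabelPacking

end Summit.MatrixMultiplication.MatrixMultiplication.Theorems.SoloVal
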